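import Literature.MathematicalPhysics.QuantumFieldTheory.Balaban1983to89.T4TermwiseSU2

/-!
# Bałaban 1983–89, node U5 / estimate NE7 (MATCHING MOD CONSTANTS), TERM-WISE route, generation 12 (third leaf):
# THE ONE-CALL INSTANTIATION — generation 10's `interpolation_averaging_of_regular` CALLED for `G = SU(2)`
# Wilson terms along Bałaban's geometric tower, with its (wt)(ker)(cnt)(tr)(bch)(ρb-scal) binders DISCHARGED by the
# lineage's theorems; what remains are the UNPRINTED binders, BY NAME

HONEST FRAMING (cell `pub-balaban`, sub-cell t4, T4-DAG page 1).  Finite 4-torus, rung (B)+1 scoping: existence and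
uniqueness of the `ε → 0` limit of unit-scale averaged expectations on a FIXED finite torus.  NOT infinite volume, NOT a
mass gap, NOT the Clay statement, NOT a proof of NE7 (NE7 is NOT PRINTED: the manuscripts under audit construct ONE
sequence of effective actions and never compare two runs).  CONDITIONALS, BY NAME, none hidden in a definition: every
remaining hypothesis of the theorem below is a binder of generation 10's `T4TermwiseQuartic.interpolation_averaging_of_regular`
carried VERBATIM — (repr-U)/(repr-L) `hreprU`/`hreprL` (the good term's `f₁`, `g` ARE the Wilson plaquette sums of the
two runs' backgrounds: a representation hypothesis, (repr)), (sz-U)/(sz-L) `hsA`/`hsB` with the size LAW `hs`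
(`s_K ≤ c₁ε₁L^{−2(K+1)}`, B11 (2) in shape — NOT PRINTED as used), (osc-U) `hoscA` with its law `hω` (two-level regularity
of the one-step lift — NOT PRINTED as an inequality; locus [Balaban1985Variational] pp. 280–286 per the cell's literature
record) — plus the CONFIGURATION hypotheses `hA`/`hB` (at every scale and every good term the two runs' background
configurations are `SU(2)`-valued, periodic of period `M·L^{K+1}` = live on the torus `T^{(K+1)}`, and satisfy B7 (44)
`|V(∂p) − 1| ≤ α₀(K)` with the Prop. 2 smallness `20480·L²·α₀(K) ≤ 1`) and the (B)-TYPE DECAY `hdecay`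
(`α₀(K) ≤ c_α ε₁ L^{−2K}` — the small-field plaquette bound improving geometrically down the tower; an INPUT in the shape
of the inductive hypothesis (B), NOT derived here).  Upstream of this theorem and untouched: (W-w), (0.31) =
`h031A`/`h031B`, (B), (B^μ), everything of generations 7–9's census (`goodClause_summable_of_kindsRA_regular` consumes the
output below exactly as it consumed generation 10's).

CITATION HEADER (lean-in-tree rule 2026-08-18).  Audit cell `pub-balaban`, sub-cell t4 (unit b2b-balaban-t4-ne7-p1-g12).
No sentence of print is quoted in this file.  The objects are those of `B7Prop1Explicit` ((9), (14), (42) of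
[Balaban1985Averaging], quoted verbatim THERE), `T4TermwiseTorus` (torus bookkeeping; torus = [Balaban1987RG1] p. 251 /
(0.1)), `T4TermwiseSU2` (quaternion model of `SU(2)`, Wilson weight of [Balaban1987RG1] (0.2) p. 252 as transcribed in the
cell's `Setup.wilsonAction`) and `T4TermwiseQuartic` (generation 10's abstract one-step deviation theorem, [folklore]).
Every declaration below is [folklore] bookkeeping; the only mathematics is already in the imported modules.

## What this module adds (namespace `…T4TermwiseInstantiate`; nothing of another lineage is edited or bumped)
`X4` (the fixed plaquette-label type `(Fin 4 × Fin 4) × ℤ⁴`), `eQ` (the weight `v ↦ 1 − cos‖v‖` on `ℍ`) with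
`eQ_sandwich` (q₄ = 1/24), `cBCH` (the constant `280·(320·L²·c_α)²` of the (bch) defect law), `smallness_four` /
`bchBound_four` (the `d = 4` numerals of `T4TermwiseSU2`: `512·5·8 = 20480`, `8·5·8 = 320`), `bch_PhiQ_four`,
`norm_PhiQ_four`, `rho_le_of_decay`, and the capstone **`interpolation_averaging_SU2`**: generation 10's
`interpolation_averaging_of_regular` with `V = ℍ`, `Xf = Xc = X4`, `e = eQ`, `q₄ = 1/24`, `Pf K = pbox planes (M·L^K·L)`,
`Pc K = pbox planes (M·L^K)`, `w K = pker (M·L^K·L) L`, `n₀ = #planes`, `vol = M⁴`, `φA K t τ v = phiQ (VA K t τ v)`,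
`ψA = psiQ L (VA …)`, `ΦA = PhiQ (M·L^K·L) L (VA …)` (same for run B), `ρb K = 280·(320·L²·α₀(K))²`,
`c₃ = cBCH L c_α` — its binders `he hq₄ hL hw hrow hcol hn₀ hvol hNf hNc hΦA hρA hΦB hρB hc₃ hρb` DISCHARGED by
`T4TermwiseQuartic.one_sub_cos_norm_sandwich`, `T4TermwiseTorus.kernel_tower_geometric`, `T4TermwiseSU2.norm_PhiQ` /
`bch_PhiQ` and elementary arithmetic; OUTPUT = generation 10's six conclusions ((U) `hUdev`, (L) `hLdev`, `hdU0`, `hdL0`,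
`hdU`, `hdL` with the explicit geometric majorants) VERBATIM with these constants.

## Binder status of `interpolation_averaging_of_regular` after this leaf (G = SU(2), Wilson terms)
DISCHARGED (theorems): (wt) `he`, `hq₄`; (ker) `hw hrow hcol`, `hL`; (cnt) `hNf hNc hn₀ hvol`; (tr) `hΦA hΦB`; (bch)
`hρA hρB`; (scal, ρb-part) `hρb hc₃` — from the configuration hypotheses `hA hB` and the decay `hdecay`.
REMAINING, BY NAME (hypotheses of `interpolation_averaging_SU2`): (repr) `hreprU hreprL`; (sz) `hsA hsB` + law `hs`,
`hc₁ hε₁`; (osc-U) `hoscA` + law `hω`; configurations `hA hB`; decay `hdecay`; torus size `2 ≤ M`, `2 ≤ L`.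
None of the remaining analytic laws is printed as used; NE7 remains NOT PRINTED and NOT PROVED.

## v1.1 (ADDITIVE; every v1 declaration byte-identical): the size binder (sz) DISCHARGED too
Following the cross-read C-pv14-119 (INFO I2): for an `SU(2)`-valued configuration under (44) with `α₀ ≤ ½`,
`‖φ_Q(x)‖ = ‖log V(∂p_x)‖ ≤ 2‖V(∂p_x) − 1‖ ≤ 2α₀` ((26) of [Balaban1985Averaging], last member, = the tree's
`MatrixLog.norm_mlog_le_two_mul`; the norm identity is the quaternion isometry `T4TermwiseSU2.norm_topRowQuat`) —
`norm_phiQ_le`; with the decay `hdecay` this gives generation 10's `hsA`/`hsB` with `s_K = 2α₀(K)` and the size LAW `hs`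
with `c₁ = cSZ L c_α = 2L²c_α` (`size_le_of_decay`).  The second capstone **`interpolation_averaging_SU2_sz`** is
`interpolation_averaging_SU2` with `hsA hsB hs hc₁` DISCHARGED (one more hypothesis `hcα : 0 ≤ c_α`).  REMAINING, BY
NAME, after v1.1: (repr) `hreprU hreprL`; (osc-U) `hoscA` + law `hω` (NOT PRINTED); configurations `hA hB`; `hαK`;
decay `hdecay` ((B)-type INPUT), `hcα`, `hε₁`; `2 ≤ M`, `2 ≤ L`.  VERSIONS: v1 p192687 (commit c31f97dc073e); v1.1 = v1 +
§5 (this paragraph, `norm_phiQ_le`, `cSZ`, `cSZ_nonneg`, `half_of_smallness`, `size_le_of_decay`,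
`interpolation_averaging_SU2_sz`).

## What is NOT delivered
SU(N ≥ 3) (constants in (id-V), see `T4TermwiseSU2`); U(1); terms other than Wilson plaquette terms ((repr) beyond
Wilson); the case `M = 1` at `K = 0` (one block per direction, excluded by `T4TermwiseTorus.bch_torus`'s `T ≥ 2L`); any
derivation of (osc-U), (sz), (repr), (B).  This file is bookkeeping: it contains no new inequality.
-/

noncomputable section

open scoped BigOperators Quaternion Matrix.Norms.L2Operator
open Finset

namespace Literature.MathematicalPhysics.QuantumFieldTheory.Balaban1983to89.T4TermwiseInstantiate

open B7Prop1Explicit B7Prop2SpecialUnitary T4TermwiseTorus T4TermwiseSU2 T4TermwiseQuartic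
open T4HaarSU2LocalDiffeo (topRowQuat)

/-! ## §1 Constants and the `d = 4` numerals -/

/-- The fixed plaquette-label type of the tower: (plane, lattice point of `ℤ⁴`) — generation 10's `Xf = Xc`.
[folklore] -/
abbrev X4 : Type := (Fin 4 × Fin 4) × B7Prop1Explicit.Site 4

/-- The `SU(2)` Wilson weight read in `V = ℍ`: `e(v) = 1 − cos‖v‖` (`T4TermwiseSU2.wilsonWeight_eq`). [folklore] -/
def eQ (v : ℍ) : ℝ := 1 - Real.cos ‖v‖

/-- (wt) for `SU(2)`: the quartic sandwich with `q₄ = 1/24` (`T4TermwiseQuartic.one_sub_cos_norm_sandwich`).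
[folklore] -/
theorem eQ_sandwich (v : ℍ) : ‖v‖ ^ 2 / 2 - 1 / 24 * ‖v‖ ^ 4 ≤ eQ v ∧ eQ v ≤ ‖v‖ ^ 2 / 2 :=
  one_sub_cos_norm_sandwich v

/-- The constant of the (bch) defect law `ρb_K ≤ c₃ ε₁² L^{−4K}`: `c₃ = 280·(320·L²·c_α)²`. [folklore] -/
def cBCH (L : ℕ) (cα : ℝ) : ℝ := 280 * (320 * (L : ℝ) ^ 2 * cα) ^ 2

/-- `0 ≤ cBCH` (generation 10's `hc₃`). [folklore] -/
theorem cBCH_nonneg (L : ℕ) (cα : ℝ) : 0 ≤ cBCH L cα := by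
  unfold cBCH; positivity

/-- `512·(4+1)·(4+4) = 20480`: the Prop. 2 smallness of `T4TermwiseSU2` at `d = 4` from the normal form
`20480·L²·α₀ ≤ 1`. [folklore] -/
theorem smallness_four {L : ℕ} {α₀ : ℝ} (h : 20480 * (L : ℝ) ^ 2 * α₀ ≤ 1) :
    512 * ((4 : ℕ) + 1 : ℝ) * ((4 : ℕ) + 4 : ℝ) * (L : ℝ) ^ 2 * α₀ ≤ 1 := by
  push_cast; linarith

/-- `8·(4+1)·(4+4) = 320`: the (bch) bound of `T4TermwiseSU2` at `d = 4` in normal form. [folklore] -/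
theorem bchBound_four (L : ℕ) (α₀ : ℝ) :
    280 * (8 * ((4 : ℕ) + 1 : ℝ) * ((4 : ℕ) + 4 : ℝ) * (L : ℝ) ^ 2 * α₀) ^ 2
      = 280 * (320 * (L : ℝ) ^ 2 * α₀) ^ 2 := by
  push_cast; ring

/-! ## §2 The one-level binders at `d = 4` in normal form -/

/-- (bch) at one level, `d = 4`, normal form: for an `SU(2)`-valued configuration under (44) with `20480·L²·α₀ ≤ 1` on a
torus of side `T ≥ 2L`, `‖ψ_Q(y) − Σ_{x ∈ pbox planes T} pker T L y x • Φ_Q(y, x)‖ ≤ 280·(320·L²·α₀)²`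
(`T4TermwiseSU2.bch_PhiQ`). [folklore] -/
theorem bch_PhiQ_four (T L : ℕ) (planes : Finset (Fin 4 × Fin 4)) (hplanes : ∀ P ∈ planes, P.1 ≠ P.2)
    {V : B7Prop1Explicit.Site 4 → Fin 4 → M₂ˣ} (hV : ∀ x κ, V x κ ∈ specialUnitaryUnits (Fin 2)) (hL : 1 ≤ L)
    (h2L : 2 * L ≤ T) {α₀ : ℝ} (hα₀ : 0 ≤ α₀) (hsmall : 20480 * (L : ℝ) ^ 2 * α₀ ≤ 1)
    (h44 : ∀ (x : B7Prop1Explicit.Site 4) (κ κ' : Fin 4), κ ≠ κ' →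
      ‖((hol V x (plaqWord κ κ') : M₂ˣ) : M₂) - 1‖ ≤ α₀)
    (y : X4) (hy : y.1 ∈ planes) :
    ‖psiQ L V y - ∑ x ∈ pbox planes T, pker T L y x • PhiQ T L V y x‖ ≤ 280 * (320 * (L : ℝ) ^ 2 * α₀) ^ 2 := by
  have h := bch_PhiQ T L planes hplanes hV hL h2L hα₀ (smallness_four hsmall) h44 y hy
  rwa [bchBound_four] at h

/-- (tr) at one level, `d = 4`, normal form (`T4TermwiseSU2.norm_PhiQ`). [folklore] -/
theorem norm_PhiQ_four (T L : ℕ) {V : B7Prop1Explicit.Site 4 → Fin 4 → M₂ˣ}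
    (hV : ∀ x κ, V x κ ∈ specialUnitaryUnits (Fin 2)) (hper : IsPeriodic T V) (hL : 1 ≤ L) {α₀ : ℝ}
    (hα₀ : 0 ≤ α₀) (hsmall : 20480 * (L : ℝ) ^ 2 * α₀ ≤ 1)
    (h44 : ∀ (x : B7Prop1Explicit.Site 4) (κ κ' : Fin 4), κ ≠ κ' →
      ‖((hol V x (plaqWord κ κ') : M₂ˣ) : M₂) - 1‖ ≤ α₀)
    (y : X4) (hy : y.1.1 ≠ y.1.2) (x : X4) : ‖PhiQ T L V y x‖ = ‖phiQ V x‖ :=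
  norm_PhiQ T L hV hper hL hα₀ (smallness_four hsmall) h44 y hy x

/-- (scal, ρb-part): the (B)-type decay `α₀(K) ≤ c_α ε₁ L^{−2K}` gives `280·(320·L²·α₀(K))² ≤ cBCH·ε₁²·L^{−4K}`.
[folklore] -/
theorem rho_le_of_decay (L : ℕ) {cα ε₁ : ℝ} {αK : ℕ → ℝ} (hα : ∀ K, 0 ≤ αK K)
    (hdecay : ∀ K, αK K ≤ cα * ε₁ * (((L : ℝ) ^ K)⁻¹) ^ 2) (K : ℕ) :
    0 ≤ 280 * (320 * (L : ℝ) ^ 2 * αK K) ^ 2 ∧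
      280 * (320 * (L : ℝ) ^ 2 * αK K) ^ 2 ≤ cBCH L cα * ε₁ ^ 2 * (((L : ℝ) ^ K)⁻¹) ^ 4 := by
  refine ⟨by positivity, ?_⟩
  have h0 : 0 ≤ 320 * (L : ℝ) ^ 2 * αK K := by have := hα K; positivity
  have h1 : 320 * (L : ℝ) ^ 2 * αK K ≤ 320 * (L : ℝ) ^ 2 * (cα * ε₁ * (((L : ℝ) ^ K)⁻¹) ^ 2) :=
    mul_le_mul_of_nonneg_left (hdecay K) (by positivity)
  have h2 := pow_le_pow_left₀ h0 h1 2
  calc 280 * (320 * (L : ℝ) ^ 2 * αK K) ^ 2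
      ≤ 280 * (320 * (L : ℝ) ^ 2 * (cα * ε₁ * (((L : ℝ) ^ K)⁻¹) ^ 2)) ^ 2 :=
        mul_le_mul_of_nonneg_left h2 (by norm_num)
    _ = cBCH L cα * ε₁ ^ 2 * (((L : ℝ) ^ K)⁻¹) ^ 4 := by unfold cBCH; ring

/-! ## §3 The capstone: generation 10's theorem CALLED for `SU(2)` Wilson terms along the geometric tower -/

section Capstone

variable {ι : Type} {σ : Type*} [DecidableEq σ] {l₀ : ℝ} {T : ℕ → Finset σ} {Bad : ℕ → ℝ → Finset σ} {Adm : Set ι}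

/-- **(U)(L) FOR `SU(2)` WILSON TERMS FROM THE LINEAGE's THEOREMS — ONE CALL of
`T4TermwiseQuartic.interpolation_averaging_of_regular`.**  Data: the torus tower `n_K = M·L^K` (`2 ≤ M`, `2 ≤ L`), a
set of genuine planes, the two runs' background CONFIGURATIONS `VA VB K t τ v : ℤ⁴ → Fin 4 → GL₂(ℂ)` (periodic lifts),
the small-field sizes `α₀(K)`.  Hypotheses: `hA`/`hB` (SU(2)-valued, `M·L^{K+1}`-periodic, (44) with `α₀(K)`),
`hαK` (`0 ≤ α₀(K)`, `20480·L²·α₀(K) ≤ 1`), `hdecay` (`α₀(K) ≤ c_α ε₁ L^{−2K}`), and generation 10's (repr)(sz)(osc-U)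
binders with their laws, VERBATIM for the concrete fields `phiQ`/`psiQ`/`PhiQ`.  Conclusion: generation 10's six
conclusions with `V = ℍ`, `e = eQ`, `q₄ = 1/24`, `n₀ = #planes`, `vol = M⁴`, `c₃ = cBCH L c_α`. [folklore] -/
theorem interpolation_averaging_SU2 {Y YA : Type*} {g : ℕ → ℝ → σ → ι → YA → ℝ}
    {f₁ : ℕ → ℝ → σ → ι → Y → ℝ} {Q : ℕ → ℝ → σ → ι → Y → YA} {yA yB : ℕ → ℝ → σ → ι → Y}
    {xA : ℕ → ℝ → σ → ι → YA}
    (M L : ℕ) (hM : 2 ≤ M) (hL : 2 ≤ L) (planes : Finset (Fin 4 × Fin 4)) (hplanes : ∀ P ∈ planes, P.1 ≠ P.2)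
    (VA VB : ℕ → ℝ → σ → ι → (B7Prop1Explicit.Site 4 → Fin 4 → M₂ˣ))
    {αK s ω : ℕ → ℝ} {cα c₁ c₂ ε₁ : ℝ}
    (hαK : ∀ K, 0 ≤ αK K ∧ 20480 * (L : ℝ) ^ 2 * αK K ≤ 1)
    (hA : ∀ K t, |t| ≤ l₀ → ∀ τ ∈ T K \ Bad K t, ∀ v ∈ Adm,
      (∀ x κ, VA K t τ v x κ ∈ specialUnitaryUnits (Fin 2)) ∧ IsPeriodic (M * L ^ K * L) (VA K t τ v) ∧
        ∀ (x : B7Prop1Explicit.Site 4) (κ κ' : Fin 4), κ ≠ κ' →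
          ‖((hol (VA K t τ v) x (plaqWord κ κ') : M₂ˣ) : M₂) - 1‖ ≤ αK K)
    (hB : ∀ K t, |t| ≤ l₀ → ∀ τ ∈ T K \ Bad K t, ∀ v ∈ Adm,
      (∀ x κ, VB K t τ v x κ ∈ specialUnitaryUnits (Fin 2)) ∧ IsPeriodic (M * L ^ K * L) (VB K t τ v) ∧
        ∀ (x : B7Prop1Explicit.Site 4) (κ κ' : Fin 4), κ ≠ κ' →
          ‖((hol (VB K t τ v) x (plaqWord κ κ') : M₂ˣ) : M₂) - 1‖ ≤ αK K)
    (hdecay : ∀ K, αK K ≤ cα * ε₁ * (((L : ℝ) ^ K)⁻¹) ^ 2)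
    (hreprU : ∀ K t, |t| ≤ l₀ → ∀ τ ∈ T K \ Bad K t, ∀ v ∈ Adm,
      f₁ K t τ v (yA K t τ v) = ∑ x ∈ pbox planes (M * L ^ K * L), eQ (phiQ (VA K t τ v) x) ∧
        g K t τ v (xA K t τ v) = ∑ y ∈ pbox planes (M * L ^ K), eQ (psiQ L (VA K t τ v) y))
    (hsA : ∀ K t, |t| ≤ l₀ → ∀ τ ∈ T K \ Bad K t, ∀ v ∈ Adm, ∀ x ∈ pbox planes (M * L ^ K * L),
      ‖phiQ (VA K t τ v) x‖ ≤ s K)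
    (hoscA : ∀ K t, |t| ≤ l₀ → ∀ τ ∈ T K \ Bad K t, ∀ v ∈ Adm, ∀ y ∈ pbox planes (M * L ^ K),
      ∀ x ∈ pbox planes (M * L ^ K * L), ∀ x' ∈ pbox planes (M * L ^ K * L),
      0 < pker (M * L ^ K * L) L y x → 0 < pker (M * L ^ K * L) L y x' →
        ‖PhiQ (M * L ^ K * L) L (VA K t τ v) y x - PhiQ (M * L ^ K * L) L (VA K t τ v) y x'‖ ≤ ω K)
    (hreprL : ∀ K t, |t| ≤ l₀ → ∀ τ ∈ T K \ Bad K t, ∀ v ∈ Adm,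
      f₁ K t τ v (yB K t τ v) = ∑ x ∈ pbox planes (M * L ^ K * L), eQ (phiQ (VB K t τ v) x) ∧
        g K t τ v (Q K t τ v (yB K t τ v)) = ∑ y ∈ pbox planes (M * L ^ K), eQ (psiQ L (VB K t τ v) y))
    (hsB : ∀ K t, |t| ≤ l₀ → ∀ τ ∈ T K \ Bad K t, ∀ v ∈ Adm, ∀ x ∈ pbox planes (M * L ^ K * L),
      ‖phiQ (VB K t τ v) x‖ ≤ s K)
    (hc₁ : 0 ≤ c₁) (hε₁ : 0 ≤ ε₁)
    (hs : ∀ K, 0 ≤ s K ∧ s K ≤ c₁ * ε₁ * (((L : ℝ) ^ (K + 1))⁻¹) ^ 2)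
    (hω : ∀ K, 0 ≤ ω K ∧ ω K ≤ c₂ * ε₁ * (((L : ℝ) ^ (K + 1))⁻¹) ^ 2 * ((L : ℝ) ^ K)⁻¹) :
    (∀ K t, |t| ≤ l₀ → ∀ τ ∈ T K \ Bad K t, ∀ v ∈ Adm,
      f₁ K t τ v (yA K t τ v) - g K t τ v (xA K t τ v)
        ≤ (M : ℝ) ^ 4 * ((planes.card : ℝ) * (c₂ ^ 2 * ε₁ ^ 2 / 4 + c₁ * cBCH L cα * ε₁ ^ 3
            + 1 / 24 * (c₁ * ε₁ + cBCH L cα * ε₁ ^ 2) ^ 4) * (((L : ℝ) ^ 2)⁻¹) ^ K)) ∧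
    (∀ K t, |t| ≤ l₀ → ∀ τ ∈ T K \ Bad K t, ∀ v ∈ Adm,
      g K t τ v (Q K t τ v (yB K t τ v)) - f₁ K t τ v (yB K t τ v)
        ≤ (M : ℝ) ^ 4 * ((planes.card : ℝ) * (c₁ * cBCH L cα * ε₁ ^ 3 + cBCH L cα ^ 2 * ε₁ ^ 4 / 2
            + 1 / 24 * (c₁ ^ 4 * ε₁ ^ 4)) * (((L : ℝ) ^ 2)⁻¹) ^ K)) ∧
    (∀ K, 0 ≤ (planes.card : ℝ) * (c₂ ^ 2 * ε₁ ^ 2 / 4 + c₁ * cBCH L cα * ε₁ ^ 3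
        + 1 / 24 * (c₁ * ε₁ + cBCH L cα * ε₁ ^ 2) ^ 4) * (((L : ℝ) ^ 2)⁻¹) ^ K) ∧
    (∀ K, 0 ≤ (planes.card : ℝ) * (c₁ * cBCH L cα * ε₁ ^ 3 + cBCH L cα ^ 2 * ε₁ ^ 4 / 2
        + 1 / 24 * (c₁ ^ 4 * ε₁ ^ 4)) * (((L : ℝ) ^ 2)⁻¹) ^ K) ∧
    Summable (fun K => (planes.card : ℝ) * (c₂ ^ 2 * ε₁ ^ 2 / 4 + c₁ * cBCH L cα * ε₁ ^ 3
        + 1 / 24 * (c₁ * ε₁ + cBCH L cα * ε₁ ^ 2) ^ 4) * (((L : ℝ) ^ 2)⁻¹) ^ K) ∧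
    Summable (fun K => (planes.card : ℝ) * (c₁ * cBCH L cα * ε₁ ^ 3 + cBCH L cα ^ 2 * ε₁ ^ 4 / 2
        + 1 / 24 * (c₁ ^ 4 * ε₁ ^ 4)) * (((L : ℝ) ^ 2)⁻¹) ^ K) := by
  have hM0 : 0 < M := by omega
  have hL0 : 0 < L := by omega
  have hL1 : 1 ≤ L := by omega
  have hLr : (1 : ℝ) < L := by exact_mod_cast (lt_of_lt_of_le one_lt_two hL)
  -- the torus side `M·L^K·L` is at least two blocks: `2L ≤ M·L^K·L`
  have h2L : ∀ K, 2 * L ≤ M * L ^ K * L := fun K =>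
    Nat.mul_le_mul_right L (le_trans hM (Nat.le_mul_of_pos_right M (pow_pos hL0 K)))
  obtain ⟨hw, hrow, hcol, hNf, hNc⟩ := kernel_tower_geometric M L hM0 hL0 planes
  have hρ := rho_le_of_decay L (fun K => (hαK K).1) hdecay
  exact interpolation_averaging_of_regular (V := ℍ) (e := eQ) (q₄ := 1 / 24) (vol := (M : ℝ) ^ 4)
    (n₀ := (planes.card : ℝ)) (c₃ := cBCH L cα)
    (Pf := fun K => pbox planes (M * L ^ K * L)) (Pc := fun K => pbox planes (M * L ^ K))
    (w := fun K => pker (M * L ^ K * L) L)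
    (φA := fun K t τ v x => phiQ (VA K t τ v) x) (ψA := fun K t τ v y => psiQ L (VA K t τ v) y)
    (ΦA := fun K t τ v y x => PhiQ (M * L ^ K * L) L (VA K t τ v) y x)
    (φB := fun K t τ v x => phiQ (VB K t τ v) x) (ψB := fun K t τ v y => psiQ L (VB K t τ v) y)
    (ΦB := fun K t τ v y x => PhiQ (M * L ^ K * L) L (VB K t τ v) y x)
    (ρb := fun K => 280 * (320 * (L : ℝ) ^ 2 * αK K) ^ 2)
    eQ_sandwich (by norm_num) hLr hw hrow hcol (Nat.cast_nonneg _) (by positivity)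
    (fun K => (hNf K).le) (fun K => (hNc K).le) hreprU
    (fun K t ht τ hτ v hv y hy x _ =>
      norm_PhiQ_four _ L (hA K t ht τ hτ v hv).1 (hA K t ht τ hτ v hv).2.1 hL1 (hαK K).1 (hαK K).2
        (hA K t ht τ hτ v hv).2.2 y (hplanes y.1 (Finset.mem_product.1 hy).1) x)
    (fun K t ht τ hτ v hv y hy =>
      bch_PhiQ_four _ L planes hplanes (hA K t ht τ hτ v hv).1 hL1 (h2L K) (hαK K).1 (hαK K).2
        (hA K t ht τ hτ v hv).2.2 y (Finset.mem_product.1 hy).1)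
    hsA hoscA hreprL
    (fun K t ht τ hτ v hv y hy x _ =>
      norm_PhiQ_four _ L (hB K t ht τ hτ v hv).1 (hB K t ht τ hτ v hv).2.1 hL1 (hαK K).1 (hαK K).2
        (hB K t ht τ hτ v hv).2.2 y (hplanes y.1 (Finset.mem_product.1 hy).1) x)
    (fun K t ht τ hτ v hv y hy =>
      bch_PhiQ_four _ L planes hplanes (hB K t ht τ hτ v hv).1 hL1 (h2L K) (hαK K).1 (hαK K).2
        (hB K t ht τ hτ v hv).2.2 y (Finset.mem_product.1 hy).1)
    hsB hc₁ (cBCH_nonneg L cα) hε₁ hs hω hρ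

end Capstone

/-! ## §5 (v1.1) The size binder (sz) DISCHARGED too: `‖φ_Q(x)‖ ≤ 2α₀` -/

/-- (sz) at one plaquette: for an `SU(2)`-valued configuration under (44) with `α₀ ≤ ½` and a genuine plane,
`‖φ_Q(x)‖ ≤ 2α₀` — `‖topRowQuat (log U)‖ = ‖log U‖` (quaternion isometry) and `‖log U‖ ≤ 2‖U − 1‖`
(`MatrixLog.norm_mlog_le_two_mul`, (26) last member). [folklore] -/
theorem norm_phiQ_le {d : ℕ} {V : B7Prop1Explicit.Site d → Fin d → M₂ˣ}
    (hV : ∀ x κ, V x κ ∈ specialUnitaryUnits (Fin 2)) {α₀ : ℝ} (hα : α₀ ≤ 1 / 2)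
    (h44 : ∀ (x : B7Prop1Explicit.Site d) (κ κ' : Fin d), κ ≠ κ' →
      ‖((hol V x (plaqWord κ κ') : M₂ˣ) : M₂) - 1‖ ≤ α₀)
    (x : (Fin d × Fin d) × B7Prop1Explicit.Site d) (hx : x.1.1 ≠ x.1.2) : ‖phiQ V x‖ ≤ 2 * α₀ := by
  have h1 : ‖((hol V x.2 (plaqWord x.1.1 x.1.2) : M₂ˣ) : M₂) - 1‖ ≤ α₀ := h44 x.2 x.1.1 x.1.2 hx
  have hrange := mlog_val_mem_range (hol_mem_SU hV x.2 (plaqWord x.1.1 x.1.2)) (by linarith)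
  show ‖topRowQuat (MatrixLog.mlog ((hol V x.2 (plaqWord x.1.1 x.1.2) : M₂ˣ) : M₂))‖ ≤ 2 * α₀
  rw [norm_topRowQuat hrange]
  calc ‖MatrixLog.mlog ((hol V x.2 (plaqWord x.1.1 x.1.2) : M₂ˣ) : M₂)‖
      ≤ 2 * ‖((hol V x.2 (plaqWord x.1.1 x.1.2) : M₂ˣ) : M₂) - 1‖ := MatrixLog.norm_mlog_le_two_mul (by linarith)
    _ ≤ 2 * α₀ := by linarith

/-- The constant of the size law `s_K ≤ c₁ ε₁ L^{−2(K+1)}` obtained from the decay: `c₁ = 2L²c_α`. [folklore] -/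
def cSZ (L : ℕ) (cα : ℝ) : ℝ := 2 * (L : ℝ) ^ 2 * cα

/-- `0 ≤ cSZ` for `0 ≤ c_α` (generation 10's `hc₁`). [folklore] -/
theorem cSZ_nonneg (L : ℕ) {cα : ℝ} (hcα : 0 ≤ cα) : 0 ≤ cSZ L cα := by
  unfold cSZ; positivity

/-- The Prop. 2 smallness `20480·L²·α₀ ≤ 1` (any `L ≥ 1`) forces `α₀ ≤ ½`. [folklore] -/
theorem half_of_smallness {L : ℕ} (hL : 1 ≤ L) {α₀ : ℝ} (hsmall : 20480 * (L : ℝ) ^ 2 * α₀ ≤ 1) :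
    α₀ ≤ 1 / 2 := by
  have hL1 : (1 : ℝ) ≤ (L : ℝ) ^ 2 := one_le_pow₀ (by exact_mod_cast hL)
  nlinarith

/-- (scal, s-part): the decay `α₀(K) ≤ c_α ε₁ L^{−2K}` gives the size law `2α₀(K) ≤ cSZ·ε₁·(L^{K+1})^{−2}`
(generation 10's `hs` with `s_K = 2α₀(K)`). [folklore] -/
theorem size_le_of_decay (L : ℕ) (hL : 1 ≤ L) {cα ε₁ : ℝ} {αK : ℕ → ℝ} (hα : ∀ K, 0 ≤ αK K)
    (hdecay : ∀ K, αK K ≤ cα * ε₁ * (((L : ℝ) ^ K)⁻¹) ^ 2) (K : ℕ) :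
    0 ≤ 2 * αK K ∧ 2 * αK K ≤ cSZ L cα * ε₁ * (((L : ℝ) ^ (K + 1))⁻¹) ^ 2 := by
  have hL0 : (L : ℝ) ≠ 0 := Nat.cast_ne_zero.2 (by omega)
  have key : cSZ L cα * ε₁ * (((L : ℝ) ^ (K + 1))⁻¹) ^ 2 = 2 * (cα * ε₁ * (((L : ℝ) ^ K)⁻¹) ^ 2) := by
    unfold cSZ; field_simp; try ring
  rw [key]
  exact ⟨by linarith [hα K], by linarith [hdecay K]⟩

section CapstoneSz

variable {ι : Type} {σ : Type*} [DecidableEq σ] {l₀ : ℝ} {T : ℕ → Finset σ} {Bad : ℕ → ℝ → Finset σ} {Adm : Set ι}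

/-- **(U)(L) FOR `SU(2)` WILSON TERMS, (sz) DISCHARGED TOO** — `interpolation_averaging_SU2` with generation 10's
`hsA`/`hsB`/`hs`/`hc₁` supplied by `norm_phiQ_le` (`s_K = 2α₀(K)`) and `size_le_of_decay` (`c₁ = cSZ L c_α`).
REMAINING hypotheses, BY NAME: `hαK`, `hA`, `hB`, `hcα`, `hdecay`, `hreprU`, `hoscA`, `hreprL`, `hε₁`, `hω`.
[folklore] -/
theorem interpolation_averaging_SU2_sz {Y YA : Type*} {g : ℕ → ℝ → σ → ι → YA → ℝ}
    {f₁ : ℕ → ℝ → σ → ι → Y → ℝ} {Q : ℕ → ℝ → σ → ι → Y → YA} {yA yB : ℕ → ℝ → σ → ι → Y}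
    {xA : ℕ → ℝ → σ → ι → YA}
    (M L : ℕ) (hM : 2 ≤ M) (hL : 2 ≤ L) (planes : Finset (Fin 4 × Fin 4)) (hplanes : ∀ P ∈ planes, P.1 ≠ P.2)
    (VA VB : ℕ → ℝ → σ → ι → (B7Prop1Explicit.Site 4 → Fin 4 → M₂ˣ))
    {αK ω : ℕ → ℝ} {cα c₂ ε₁ : ℝ}
    (hαK : ∀ K, 0 ≤ αK K ∧ 20480 * (L : ℝ) ^ 2 * αK K ≤ 1)
    (hA : ∀ K t, |t| ≤ l₀ → ∀ τ ∈ T K \ Bad K t, ∀ v ∈ Adm,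
      (∀ x κ, VA K t τ v x κ ∈ specialUnitaryUnits (Fin 2)) ∧ IsPeriodic (M * L ^ K * L) (VA K t τ v) ∧
        ∀ (x : B7Prop1Explicit.Site 4) (κ κ' : Fin 4), κ ≠ κ' →
          ‖((hol (VA K t τ v) x (plaqWord κ κ') : M₂ˣ) : M₂) - 1‖ ≤ αK K)
    (hB : ∀ K t, |t| ≤ l₀ → ∀ τ ∈ T K \ Bad K t, ∀ v ∈ Adm,
      (∀ x κ, VB K t τ v x κ ∈ specialUnitaryUnits (Fin 2)) ∧ IsPeriodic (M * L ^ K * L) (VB K t τ v) ∧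
        ∀ (x : B7Prop1Explicit.Site 4) (κ κ' : Fin 4), κ ≠ κ' →
          ‖((hol (VB K t τ v) x (plaqWord κ κ') : M₂ˣ) : M₂) - 1‖ ≤ αK K)
    (hcα : 0 ≤ cα) (hdecay : ∀ K, αK K ≤ cα * ε₁ * (((L : ℝ) ^ K)⁻¹) ^ 2)
    (hreprU : ∀ K t, |t| ≤ l₀ → ∀ τ ∈ T K \ Bad K t, ∀ v ∈ Adm,
      f₁ K t τ v (yA K t τ v) = ∑ x ∈ pbox planes (M * L ^ K * L), eQ (phiQ (VA K t τ v) x) ∧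
        g K t τ v (xA K t τ v) = ∑ y ∈ pbox planes (M * L ^ K), eQ (psiQ L (VA K t τ v) y))
    (hoscA : ∀ K t, |t| ≤ l₀ → ∀ τ ∈ T K \ Bad K t, ∀ v ∈ Adm, ∀ y ∈ pbox planes (M * L ^ K),
      ∀ x ∈ pbox planes (M * L ^ K * L), ∀ x' ∈ pbox planes (M * L ^ K * L),
      0 < pker (M * L ^ K * L) L y x → 0 < pker (M * L ^ K * L) L y x' →
        ‖PhiQ (M * L ^ K * L) L (VA K t τ v) y x - PhiQ (M * L ^ K * L) L (VA K t τ v) y x'‖ ≤ ω K)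
    (hreprL : ∀ K t, |t| ≤ l₀ → ∀ τ ∈ T K \ Bad K t, ∀ v ∈ Adm,
      f₁ K t τ v (yB K t τ v) = ∑ x ∈ pbox planes (M * L ^ K * L), eQ (phiQ (VB K t τ v) x) ∧
        g K t τ v (Q K t τ v (yB K t τ v)) = ∑ y ∈ pbox planes (M * L ^ K), eQ (psiQ L (VB K t τ v) y))
    (hε₁ : 0 ≤ ε₁)
    (hω : ∀ K, 0 ≤ ω K ∧ ω K ≤ c₂ * ε₁ * (((L : ℝ) ^ (K + 1))⁻¹) ^ 2 * ((L : ℝ) ^ K)⁻¹) :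
    (∀ K t, |t| ≤ l₀ → ∀ τ ∈ T K \ Bad K t, ∀ v ∈ Adm,
      f₁ K t τ v (yA K t τ v) - g K t τ v (xA K t τ v)
        ≤ (M : ℝ) ^ 4 * ((planes.card : ℝ) * (c₂ ^ 2 * ε₁ ^ 2 / 4 + cSZ L cα * cBCH L cα * ε₁ ^ 3
            + 1 / 24 * (cSZ L cα * ε₁ + cBCH L cα * ε₁ ^ 2) ^ 4) * (((L : ℝ) ^ 2)⁻¹) ^ K)) ∧
    (∀ K t, |t| ≤ l₀ → ∀ τ ∈ T K \ Bad K t, ∀ v ∈ Adm,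
      g K t τ v (Q K t τ v (yB K t τ v)) - f₁ K t τ v (yB K t τ v)
        ≤ (M : ℝ) ^ 4 * ((planes.card : ℝ) * (cSZ L cα * cBCH L cα * ε₁ ^ 3 + cBCH L cα ^ 2 * ε₁ ^ 4 / 2
            + 1 / 24 * (cSZ L cα ^ 4 * ε₁ ^ 4)) * (((L : ℝ) ^ 2)⁻¹) ^ K)) ∧
    (∀ K, 0 ≤ (planes.card : ℝ) * (c₂ ^ 2 * ε₁ ^ 2 / 4 + cSZ L cα * cBCH L cα * ε₁ ^ 3
        + 1 / 24 * (cSZ L cα * ε₁ + cBCH L cα * ε₁ ^ 2) ^ 4) * (((L : ℝ) ^ 2)⁻¹) ^ K) ∧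
    (∀ K, 0 ≤ (planes.card : ℝ) * (cSZ L cα * cBCH L cα * ε₁ ^ 3 + cBCH L cα ^ 2 * ε₁ ^ 4 / 2
        + 1 / 24 * (cSZ L cα ^ 4 * ε₁ ^ 4)) * (((L : ℝ) ^ 2)⁻¹) ^ K) ∧
    Summable (fun K => (planes.card : ℝ) * (c₂ ^ 2 * ε₁ ^ 2 / 4 + cSZ L cα * cBCH L cα * ε₁ ^ 3
        + 1 / 24 * (cSZ L cα * ε₁ + cBCH L cα * ε₁ ^ 2) ^ 4) * (((L : ℝ) ^ 2)⁻¹) ^ K) ∧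
    Summable (fun K => (planes.card : ℝ) * (cSZ L cα * cBCH L cα * ε₁ ^ 3 + cBCH L cα ^ 2 * ε₁ ^ 4 / 2
        + 1 / 24 * (cSZ L cα ^ 4 * ε₁ ^ 4)) * (((L : ℝ) ^ 2)⁻¹) ^ K) := by
  have hL1 : 1 ≤ L := by omega
  have hhalf : ∀ K, αK K ≤ 1 / 2 := fun K => half_of_smallness hL1 (hαK K).2
  exact interpolation_averaging_SU2 (s := fun K => 2 * αK K) (c₁ := cSZ L cα) M L hM hL planes hplanes VA VB hαK
    hA hB hdecay hreprU
    (fun K t ht τ hτ v hv x hx =>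
      norm_phiQ_le (hA K t ht τ hτ v hv).1 (hhalf K) (hA K t ht τ hτ v hv).2.2 x
        (hplanes x.1 (Finset.mem_product.1 hx).1))
    hoscA hreprL
    (fun K t ht τ hτ v hv x hx =>
      norm_phiQ_le (hB K t ht τ hτ v hv).1 (hhalf K) (hB K t ht τ hτ v hv).2.2 x
        (hplanes x.1 (Finset.mem_product.1 hx).1))
    (cSZ_nonneg L hcα) hε₁ (size_le_of_decay L hL1 (fun K => (hαK K).1) hdecay) hω

end CapstoneSz

/-! ## §4 Toy (non-vacuity of the configuration hypotheses): the constant configuration satisfies `hA` at every level -/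

section Toy

/-- The constant configuration `V ≡ 1` is `SU(2)`-valued, periodic of every period, and satisfies (44) with `α₀ = 0`
— so the configuration hypotheses `hA`/`hB` of `interpolation_averaging_SU2` are satisfiable at every scale (with
`αK ≡ 0`, which also satisfies `hαK` and `hdecay` with `c_α = 0`). [folklore] -/
theorem const_config_hyps (N : ℕ) :
    (∀ (x : B7Prop1Explicit.Site 4) (κ : Fin 4),
        (fun (_ : B7Prop1Explicit.Site 4) (_ : Fin 4) => (1 : M₂ˣ)) x κ ∈ specialUnitaryUnits (Fin 2)) ∧
      IsPeriodic N (fun (_ : B7Prop1Explicit.Site 4) (_ : Fin 4) => (1 : M₂ˣ)) ∧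
      ∀ (x : B7Prop1Explicit.Site 4) (κ κ' : Fin 4), κ ≠ κ' →
        ‖((hol (fun (_ : B7Prop1Explicit.Site 4) (_ : Fin 4) => (1 : M₂ˣ)) x (plaqWord κ κ') : M₂ˣ) : M₂) - 1‖
          ≤ (0 : ℝ) := by
  refine ⟨fun _ _ => Subgroup.one_mem _, fun _ _ => rfl, fun x κ κ' _ => ?_⟩
  rw [hol_const_one]; simp

/-- … and `αK ≡ 0`, `c_α = 0` satisfy `hαK` and `hdecay`. [folklore] -/
example (L K : ℕ) (ε₁ : ℝ) :
    ((0 : ℝ) ≤ 0 ∧ 20480 * (L : ℝ) ^ 2 * 0 ≤ 1) ∧ (0 : ℝ) ≤ 0 * ε₁ * (((L : ℝ) ^ K)⁻¹) ^ 2 := by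
  refine ⟨⟨le_rfl, by norm_num⟩, by simp⟩

end Toy

end Literature.MathematicalPhysics.QuantumFieldTheory.Balaban1983to89.T4TermwiseInstantiate
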